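import Mathlib.RingTheory.MvPolynomial.Homogeneous
import Mathlib.Algebra.CharP.Lemmas
import Mathlib.RingTheory.MvPolynomial.Basic
import Mathlib.Algebra.BigOperators.Fin
import Mathlib.Data.Fin.VecNotation
import Summits.ValiantsHypothesis.ValiantsHypothesis.Theorems.GrenetZeonHessianRankCodimTwoLatinFrobeniusDefs
import HarnessLib

/-!
# Crux `GrenetZeon.HessianRankCodimTwo` (stmt-ValiantsHypothesis-8061), line `good_plane` v2,
# stub `stub_goodPlaneThreePrime` — Theorem P, PART A(i): generating functions, base-`p` digits,
# and the congruence `Φ̃_p = F^p`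

Vocabulary: `Theorems/GrenetZeonHessianRankCodimTwoLatinFrobeniusDefs.lean` (`rowForm`, `cubicF`,
`quadP`, `latinPhi`, `latinPsi`).  This file proves, for the row forms `ℓ_I(y) = Σ_J x_{J-I} y_J`
of the generic circulant:

* the COLOURING / TABLE BRIDGE `coeff_prod_rowForm`: for any `blk : ι → Fin 3` the coefficient of
  `y^ν` in `Π_r ℓ_{blk r}` is `Σ_{g : ι → Fin 3, Σ_r e_{g r} = ν} Π_r x_{g r - blk r}` (so the
  permanent of the Latin block point and its block values are, up to the factorial fibre counts of
  PART B, the coefficients `latinPhi`, `latinPsi`);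
* the DIGIT LEMMA `coeff_add_smul_mul_monomial`: with all exponents of `Q` and of `β` below `p`,
  `[y^{β + pδ}] (Q · c y^{pδ'}) = [δ' = δ] c · [y^β] Q`;
* `[y_J^k] ℓ_I^k = x_{J-I}^k` (`coeff_single_rowForm_pow`);
* Frobenius `ℓ_I^p = Σ_J x_{J-I}^p y_J^p` in characteristic `p` (`rowForm_pow_prime`) and
  **congruence 1 of Theorem P**: `[y_0^p y_1^p y_2^p] ℓ_0^p ℓ_1^p ℓ_2^p = F^p`,
  `F = x_0³+x_1³+x_2³+3x_0x_1x_2` (`coeff_prod_rowForm_pow_prime`; the only colourings surviving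
  Frobenius are the bijections `Fin 3 → Fin 3`, whose weight sum is `per circ(x) = F`).

Congruence 2 (block values) and the evaluated / homogeneity / base-change corollaries are in
`…LatinFrobeniusBlock.lean`.  Source: line memo `Cruxes/HessianRankCodimTwo/GoodPlanesLatinReduction.md`
§6 (val-width-8061-p2).  VP ≠ VNP is not moved: the crux only feeds the constant-factor bound
`TwoDimCoefficients`.
-/

noncomputable section

open MvPolynomial Finset

-- single-conjunct layout `Summits/ValiantsHypothesis/ValiantsHypothesis`: duplicated namespace by design
set_option linter.dupNamespace false

namespace Summit.ValiantsHypothesis.ValiantsHypothesis.Theorems.GrenetZeonHessianRankCodimTwo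

variable {R : Type*} [CommRing R]
/-- Unfolding lemma for `rowForm`. [folklore] -/
theorem rowForm_def (I : Fin 3) :
    rowForm R I = ∑ J : Fin 3, C (X (J - I)) * (X J : MvPolynomial (Fin 3) (MvPolynomial (Fin 3) R)) :=
  rfl

/-! ### Generating functions: products of sums of monomial terms -/

section GF

variable {τ : Type*} {A : Type*} [CommSemiring A] {ι : Type*} [Fintype ι] [DecidableEq ι]
  {κ : Type*} [Fintype κ]

/-- Expanding a product of sums of terms `c_{r,J} · y_J^{k_r}`: a sum over choice functions `g`
of `(Π_r c_{r, g r}) · y^{Σ_r k_r e_{g r}}`. [folklore] -/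
theorem prod_sum_C_mul_X_pow (c : ι → κ → A) (k : ι → ℕ) :
    (∏ r, ∑ J, C (c r J) * (X J : MvPolynomial κ A) ^ k r) =
      ∑ g : ι → κ, C (∏ r, c r (g r)) * monomial (∑ r, Finsupp.single (g r) (k r)) 1 := by
  classical
  rw [Finset.prod_univ_sum (fun _ => (Finset.univ : Finset κ)) (fun r J => C (c r J) * X J ^ k r),
    Fintype.piFinset_univ]
  refine Finset.sum_congr rfl fun g _ => ?_
  rw [Finset.prod_mul_distrib, map_prod, monomial_sum_one]
  congr 1
  exact Finset.prod_congr rfl fun r _ => X_pow_eq_monomial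

/-- Coefficient extraction from a product of sums of terms `c_{r,J} · y_J^{k_r}`: the coefficient of
`y^ν` is the sum of `Π_r c_{r, g r}` over the choice functions `g` with `Σ_r k_r e_{g r} = ν`.
[folklore] -/
theorem coeff_prod_sum_C_mul_X_pow [DecidableEq κ] (c : ι → κ → A) (k : ι → ℕ)
    (ν : κ →₀ ℕ) :
    coeff ν (∏ r, ∑ J, C (c r J) * (X J : MvPolynomial κ A) ^ k r) =
      ∑ g ∈ univ.filter (fun g : ι → κ => (∑ r, Finsupp.single (g r) (k r)) = ν),
        ∏ r, c r (g r) := by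
  rw [prod_sum_C_mul_X_pow, coeff_sum, Finset.sum_filter]
  refine Finset.sum_congr rfl fun g _ => ?_
  rw [coeff_C_mul, coeff_monomial]
  split_ifs <;> simp

end GF

/-- **Colouring / table bridge.**  For any assignment `blk` of rows to row blocks, the coefficient of
`y^ν` in `Π_r ℓ_{blk r}` is the sum, over the colourings `g` of the rows by column blocks with colour
multiplicities `ν`, of the weights `Π_r x_{g r - blk r}`.  (With `blk` = the block map of
`Fin 3p` and `ν = (p,p,p)` this is the permanent of the Latin block point divided by `(p!)³`; with two
rows of one block removed and `ν = (p,p,p) - 2e_J` it is a block value divided by `(p-2)!·p!·p!` —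
the fibre count is NOT in this file.) [folklore] -/
theorem coeff_prod_rowForm {ι : Type*} [Fintype ι] [DecidableEq ι] (blk : ι → Fin 3)
    (ν : Fin 3 →₀ ℕ) :
    coeff ν (∏ r, rowForm R (blk r)) =
      ∑ g ∈ univ.filter (fun g : ι → Fin 3 => (∑ r, Finsupp.single (g r) 1) = ν),
        ∏ r, X (g r - blk r) := by
  have h := coeff_prod_sum_C_mul_X_pow (A := MvPolynomial (Fin 3) R)
    (fun r J => (X (J - blk r) : MvPolynomial (Fin 3) R)) (fun _ => 1) ν
  simp only [pow_one] at h
  exact h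

/-! ### Base-`p` digits of exponent vectors -/

section Digits

variable {τ : Type*} {A : Type*} [CommSemiring A]

/-- **Digit lemma.**  If every exponent vector of `Q` and the vector `β` have all entries `< p`, then
the coefficient of `y^{β + p δ}` in `Q · c y^{p δ'}` is `c · coeff_β Q` if `δ' = δ` and `0`
otherwise (uniqueness of base-`p` digits, coordinatewise). [folklore] -/
theorem coeff_add_smul_mul_monomial (p : ℕ) (hp : 0 < p) (Q : MvPolynomial τ A)
    (hQ : ∀ m ∈ Q.support, ∀ K, m K < p) (β : τ →₀ ℕ) (hβ : ∀ K, β K < p) (δ δ' : τ →₀ ℕ)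
    (c : A) [Decidable (δ' = δ)] :
    coeff (β + p • δ) (Q * monomial (p • δ') c) = if δ' = δ then coeff β Q * c else 0 := by
  classical
  rw [coeff_mul_monomial']
  by_cases h : δ' = δ
  · subst h
    rw [if_pos le_add_self, if_pos rfl, add_tsub_cancel_right]
  · rw [if_neg h]
    split_ifs with hle
    · suffices hz : coeff (β + p • δ - p • δ') Q = 0 by rw [hz, zero_mul]
      rw [← notMem_support_iff]
      intro hm
      apply h
      ext K
      have h1 := hQ _ hm K
      have h2 : (β + p • δ - p • δ') K + p * δ' K = β K + p * δ K := by
        have := congrArg (fun f : τ →₀ ℕ => f K) (tsub_add_cancel_of_le hle)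
        simpa using this
      have h3 : ((β + p • δ - p • δ') K + p * δ' K) / p = δ' K := by
        rw [Nat.add_mul_div_left _ _ hp, Nat.div_eq_of_lt h1, zero_add]
      have h4 : (β K + p * δ K) / p = δ K := by
        rw [Nat.add_mul_div_left _ _ hp, Nat.div_eq_of_lt (hβ K), zero_add]
      rw [← h3, h2, h4]
    · rfl

end Digits

/-! ### Powers of one row form -/

/-- The row forms are homogeneous linear forms in `y`. [folklore] -/
theorem rowForm_isHomogeneous (I : Fin 3) : (rowForm R I).IsHomogeneous 1 := by
  unfold rowForm
  exact IsHomogeneous.sum _ _ _ fun J _ => isHomogeneous_C_mul_X _ _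

/-- Exponent vectors occurring in `ℓ_I^k` have all entries `≤ k`. [folklore] -/
theorem apply_le_of_mem_support_rowForm_pow (I : Fin 3) (k : ℕ) {m : Fin 3 →₀ ℕ}
    (hm : m ∈ (rowForm R I ^ k).support) (K : Fin 3) : m K ≤ k := by
  have hdeg : m.degree = k := by
    have h := (rowForm_isHomogeneous (R := R) I).pow k
    rw [one_mul] at h
    have h' := h (mem_support_iff.mp hm)
    rw [Finsupp.degree_eq_weight_one]
    exact h'
  rw [← hdeg]
  exact Finsupp.le_degree K m

/-- `[y_J^k] ℓ_I^k = x_{J-I}^k`. [folklore] -/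
theorem coeff_single_rowForm_pow (I J : Fin 3) (k : ℕ) :
    coeff (Finsupp.single J k) (rowForm R I ^ k) = X (J - I) ^ k := by
  classical
  induction k with
  | zero => simp
  | succ k ih =>
    rw [pow_succ, rowForm_def, Finset.mul_sum, coeff_sum]
    have key : ∀ J' : Fin 3, coeff (Finsupp.single J (k + 1))
        (rowForm R I ^ k * (C (X (J' - I)) * X J')) =
        if J' = J then X (J - I) ^ (k + 1) else 0 := by
      intro J'
      rw [show (C (X (J' - I)) * X J' : MvPolynomial (Fin 3) (MvPolynomial (Fin 3) R)) =
          monomial (Finsupp.single J' 1) (X (J' - I)) by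
        rw [C_mul_X_eq_monomial], coeff_mul_monomial']
      by_cases hJ : J' = J
      · subst hJ
        rw [if_pos (Finsupp.single_le_iff.mpr (by simp)), if_pos rfl,
          show Finsupp.single J' (k + 1) - Finsupp.single J' 1 = Finsupp.single J' k by
            rw [← Finsupp.single_tsub]; rfl,
          ih, pow_succ]
      · rw [if_neg, if_neg hJ]
        rw [Finsupp.single_le_iff, Finsupp.single_apply, if_neg (Ne.symm hJ)]
        omega
    simp_rw [← rowForm_def, key]
    rw [Finset.sum_ite_eq' Finset.univ J]
    simp

/-! ### Frobenius -/

section Frobenius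

variable (p : ℕ) [hp : Fact p.Prime] [CharP R p]

/-- Frobenius on a row form: `ℓ_I(y)^p = Σ_J x_{J-I}^p y_J^p` in characteristic `p`. [folklore] -/
theorem rowForm_pow_prime (I : Fin 3) :
    rowForm R I ^ p = ∑ J : Fin 3, C (X (J - I) ^ p) * (X J) ^ p := by
  rw [rowForm_def, sum_pow_char]
  simp_rw [mul_pow, ← map_pow]

/-- Colour multiplicities: `Σ_I p · e_{g I} = Σ_K p · e_K` iff `Σ_I e_{g I} = Σ_K e_K`. [folklore] -/
theorem sum_single_prime_eq_iff (g : Fin 3 → Fin 3) :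
    ((∑ I, Finsupp.single (g I) p) = ∑ K : Fin 3, Finsupp.single K p) ↔
      ((∑ I, Finsupp.single (g I) 1) = ∑ K : Fin 3, Finsupp.single K 1) := by
  have h : ∀ f : Fin 3 → Fin 3, (∑ I, Finsupp.single (f I) p) = p • ∑ I, Finsupp.single (f I) 1 := by
    intro f
    rw [Finset.smul_sum]
    simp_rw [Finsupp.smul_single, smul_eq_mul, mul_one]
  have h1 : (∑ K : Fin 3, Finsupp.single K p) = p • ∑ K : Fin 3, Finsupp.single K 1 := by
    rw [Finset.smul_sum]
    simp_rw [Finsupp.smul_single, smul_eq_mul, mul_one]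
  rw [h g, h1]
  exact (smul_right_injective (Fin 3 →₀ ℕ) hp.out.ne_zero).eq_iff

/-- For `g : Fin 3 → Fin 3`: `Σ_I e_{g I} = Σ_K e_K` iff `g` takes pairwise distinct values.
[folklore] -/
theorem sum_single_one_eq_iff (g : Fin 3 → Fin 3) :
    ((∑ I, Finsupp.single (g I) 1) = ∑ K : Fin 3, Finsupp.single K 1) ↔
      (g 0 ≠ g 1 ∧ g 0 ≠ g 2 ∧ g 1 ≠ g 2) := by
  classical
  constructor
  · intro h
    have hK : ∀ K : Fin 3, (∑ I, (if g I = K then 1 else 0 : ℕ)) = 1 := by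
      intro K
      have := congrArg (fun f : Fin 3 →₀ ℕ => f K) h
      simpa [Finsupp.finsetSum_apply, Finsupp.single_apply, eq_comm] using this
    refine ⟨fun h01 => ?_, fun h02 => ?_, fun h12 => ?_⟩
    · have := hK (g 1)
      rw [Fin.sum_univ_three, h01] at this
      simp only [if_true] at this
      split_ifs at this <;> omega
    · have := hK (g 2)
      rw [Fin.sum_univ_three, h02] at this
      simp only [if_true] at this
      split_ifs at this <;> omega
    · have := hK (g 2)
      rw [Fin.sum_univ_three, h12] at this
      simp only [if_true] at this
      split_ifs at this <;> omega
  · rintro ⟨h01, h02, h12⟩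
    have hinj : Function.Injective g := by
      intro a b hab
      fin_cases a <;> fin_cases b
      all_goals first | rfl | (exfalso; simp only at hab; first
        | exact h01 hab | exact h01 hab.symm | exact h02 hab | exact h02 hab.symm
        | exact h12 hab | exact h12 hab.symm)
    have hbij : Function.Bijective g := Finite.injective_iff_bijective.mp hinj
    exact Fintype.sum_bijective g hbij _ _ fun _ => rfl

/-- Sums over maps `Fin 3 → Fin 3` as triple sums. [folklore] -/
theorem sum_fun_fin_three {M : Type*} [AddCommMonoid M] (Φ : (Fin 3 → Fin 3) → M) :
    (∑ g, Φ g) = ∑ a, ∑ b, ∑ c, Φ ![a, b, c] := by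
  let e : Fin 3 × Fin 3 × Fin 3 ≃ (Fin 3 → Fin 3) :=
    { toFun := fun t => ![t.1, t.2.1, t.2.2]
      invFun := fun g => (g 0, g 1, g 2)
      left_inv := fun t => rfl
      right_inv := fun g => by funext i; fin_cases i <;> rfl }
  rw [← Fintype.sum_equiv e (fun t => Φ (e t)) Φ (fun _ => rfl), Fintype.sum_prod_type,
    Finset.sum_congr rfl fun a _ => Fintype.sum_prod_type _]
  rfl

/-- The permanent of the generic circulant: `Σ_{g bijective} Π_I x_{g I - I} = F`. [folklore] -/
theorem sum_distinct_prod_X_sub_eq_cubicF :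
    (∑ g ∈ univ.filter (fun g : Fin 3 → Fin 3 =>
        (∑ I, Finsupp.single (g I) 1) = ∑ K : Fin 3, Finsupp.single K 1),
      ∏ I, (X (g I - I) : MvPolynomial (Fin 3) R)) = cubicF R := by
  rw [Finset.filter_congr (fun g _ => sum_single_one_eq_iff g), Finset.sum_filter,
    sum_fun_fin_three]
  simp only [Fin.sum_univ_three, Fin.prod_univ_three, Matrix.cons_val_zero, Matrix.cons_val_one,
    Matrix.head_cons, Matrix.cons_val_two, Matrix.tail_cons]
  simp only [Fin.isValue, ne_eq, Fin.reduceEq, not_false_eq_true, not_true_eq_false, and_self,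
    and_true, and_false, if_true, if_false, Fin.reduceSub, sub_self, sub_zero,
    zero_add, add_zero, cubicF]
  ring

/-- **Frobenius congruence for the permanent generating function (Theorem P, `Φ̃_p ≡ F^p`).**  In
characteristic `p`, the coefficient of `(y_0 y_1 y_2)^p` in `ℓ_0^p ℓ_1^p ℓ_2^p` is
`F^p = (x_0³ + x_1³ + x_2³ + 3x_0x_1x_2)^p`. [folklore] -/
theorem coeff_prod_rowForm_pow_prime :
    coeff (∑ K : Fin 3, Finsupp.single K p) (∏ I, rowForm R I ^ p) = cubicF R ^ p := by
  classical
  simp_rw [rowForm_pow_prime]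
  rw [coeff_prod_sum_C_mul_X_pow, Finset.filter_congr (fun g _ => sum_single_prime_eq_iff p g)]
  simp_rw [Finset.prod_pow]
  rw [← sum_pow_char, sum_distinct_prod_X_sub_eq_cubicF]

end Frobenius

end Summit.ValiantsHypothesis.ValiantsHypothesis.Theorems.GrenetZeonHessianRankCodimTwo
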